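import Summits.Ventures.HodgeRepro2.T5CyclotomicSevenSplitPrime

/-!
# Every rational prime of order `2` modulo `7` gives DEGREE-ONE places of `ℚ(ζ₇)⁺` that stay prime in `ℚ(ζ₇)`:
# `N(v) = p`, three such places above `p`

Tier-5 support N3 / §G-N4.2 (seat p3, gen 79). Files 256 / 258 treat the primes `p` of order `6` (one place `(p)` of
`ℚ(ζ₇)⁺`, inert, `N(v) = p³`) and of order `3` (one place `(p)`, split, `N(v) = p³`). This file treats the primes of
order `2` modulo `7` — `p ≡ 6 (mod 7)`: `13, 41, 83, 97, …` — where the residue cardinality of the place of `ℚ(ζ₇)⁺`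
is the PRIME ITSELF: `p` splits into THREE places `v` of the cubic field `ℚ(ζ₇)⁺`, each of norm `p`, and each stays
prime in `ℚ(ζ₇)` (its unique prime above has norm `p²`). The argument is the Galois-cubic one: `ℚ(ζ₇)⁺/ℚ` is Galois
(an intermediate field of the abelian extension `ℚ(ζ₇)/ℚ`), so `f(v/p) ∣ 3`; the tower law gives
`f(v/p) · f(P/v) = f(P/p) = 2`, so `f(v/p) ∣ 2`; hence `f(v/p) = 1`, `f(P/v) = 2`, `e(P/v) = 1`, one prime above `v`
(the fundamental identity on `ℚ(ζ₇)/ℚ(ζ₇)⁺`), `v 𝓞_K = P` and `N(v) = p`: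

* `inertiaDeg_dvd_finrank_of_isGalois` — in a Galois number field `F` the inertia degree of a prime above `p` divides
  `[F : ℚ]` (Mathlib's Galois fundamental identity);
* `plusField`, `isGalois_plusField`, **`isGalois_maximalRealSubfield`** — `ℚ(ζ₇)⁺/ℚ` is Galois;
* `not_dvd_seven_of_orderOf_eq_two`, `inertiaDeg_of_liesOver_of_orderOf_eq_two`,
  `ramificationIdx_of_liesOver_of_orderOf_eq_two` — `f(P/p) = 2`, `e(P/p) = 1` in `ℚ(ζ₇)`;
* `inertiaDeg_dvd_three`, `inertiaDeg_mul_eq_two`, **`inertiaDeg_eq_one`** — `f(v/p) = 1` for every place `v` of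
  `ℚ(ζ₇)⁺` above `p`; `inertiaDeg_over_eq_two`, `ramificationIdx_over_eq_one`, `ramificationIdx_eq_one` — `f(P/v) = 2`,
  `e(P/v) = 1`, `e(v/p) = 1`;
* **`ncard_primesOver_eq_one`**, **`map_eq`**, `exists_liesOver_and_map_eq` — `v` stays prime in `ℚ(ζ₇)`;
  **`absNorm_eq`** — `N(v) = p`; **`ncard_primesOver_int_eq_three`** — exactly three places of `ℚ(ζ₇)⁺` above `p`;
* the instance `p = 13`: `orderOf_thirteen_zmod_seven`, `fact_prime_thirteen`,
  **`exists_liesOver_thirteen_and_absNorm_eq_and_map_eq`** (a place of norm `13` that stays prime),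
  `ncard_primesOver_thirteen` (three places above `13`).

§8(d): uses an L-value-free non-vanishing device: NO.
-/

open NumberField NumberField.IsCMField IsDedekindDomain IsDedekindDomain.HeightOneSpectrum Module Polynomial
open Summit.Ventures.HodgeRepro2.T5RecordSatakeInert Summit.Ventures.HodgeRepro2.T5InertDegreeAdicCompletion
  Summit.Ventures.HodgeRepro2.T5FinitePlaceSplitIff Summit.Ventures.HodgeRepro2.T5InertGlobalPrime
  Summit.Ventures.HodgeRepro2.T5FinitePlaceCM Summit.Ventures.HodgeRepro2.T5FinitePlaceNormIndex
  Summit.Ventures.HodgeRepro2.T5CMFieldSquareDatum Summit.Ventures.HodgeRepro2.T5NonSplitPlaceUnitaryGroup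
  Summit.Ventures.HodgeRepro2.T5FinitePlaceLocalDegree Summit.Ventures.HodgeRepro2.T5RecordSatakeIntrinsic
  Summit.Ventures.HodgeRepro2.T5CyclotomicSevenInertThree Summit.Ventures.HodgeRepro2.T5CyclotomicSevenInertPrime
  Summit.Ventures.HodgeRepro2.T5CyclotomicSevenSplitTwo Summit.Ventures.HodgeRepro2.T5CyclotomicSevenSplitPrime

namespace Summit.Ventures.HodgeRepro2.T5CyclotomicSevenDegreeOnePrime

section Galois

/-- **In a Galois number field `F`, the inertia degree of every prime above `p` divides `[F : ℚ]`** — the Galois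
form of the fundamental identity `g · e · f = [F : ℚ]` (Mathlib's
`Ideal.ncard_primesOver_mul_ramificationIdxIn_mul_inertiaDegIn` for `Gal(F/ℚ)` acting on `𝓞_F`). -/
theorem inertiaDeg_dvd_finrank_of_isGalois (F : Type*) [Field F] [NumberField F] [IsGalois ℚ F]
    (p : ℕ) [hp : Fact p.Prime] (𝔭 : Ideal (𝓞 F)) [𝔭.IsPrime] [𝔭.LiesOver (Ideal.span {(p : ℤ)})] :
    𝔭.inertiaDeg ℤ ∣ finrank ℚ F := by
  haveI : (Ideal.span {(p : ℤ)}).IsPrime :=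
    (Ideal.span_singleton_prime (Nat.cast_ne_zero.mpr hp.out.ne_zero)).mpr (Nat.prime_iff_prime_int.mp hp.out)
  have h := Ideal.ncard_primesOver_mul_ramificationIdxIn_mul_inertiaDegIn (Ideal.span {(p : ℤ)}) (𝓞 F)
    (F ≃ₐ[ℚ] F)
  rw [Ideal.inertiaDegIn_eq_inertiaDeg _ 𝔭 (F ≃ₐ[ℚ] F), IsGaloisGroup.card_eq_finrank (F ≃ₐ[ℚ] F) ℚ F] at h
  exact ⟨((Ideal.span {(p : ℤ)}).primesOver (𝓞 F)).ncard * (Ideal.span {(p : ℤ)}).ramificationIdxIn (𝓞 F),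
    by rw [← h]; ring⟩

end Galois

section Arithmetic

variable (p : ℕ) [hp : Fact p.Prime]

/-- A prime of order `2` modulo `7` is not `7` (the class of `7` is `0`, of order `0`). -/
theorem not_dvd_seven_of_orderOf_eq_two (h2 : orderOf (p : ZMod 7) = 2) : ¬ p ∣ 7 := by
  intro hdvd
  rcases (Nat.prime_seven.eq_one_or_self_of_dvd p hdvd) with h | h
  · exact hp.out.one_lt.ne' h
  · rw [h, ZMod.natCast_self] at h2
    have h0 : orderOf (0 : ZMod 7) = 0 := orderOf_eq_zero_iff'.mpr fun n hn => by
      rw [zero_pow hn.ne']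
      decide
    rw [h0] at h2
    exact absurd h2 (by norm_num)

end Arithmetic

section Seven

variable (K : Type*) [Field K] [CharZero K] [IsCyclotomicExtension {7} ℚ K]

/-- `ℚ(ζ₇)⁺` as an intermediate field of `ℚ(ζ₇)/ℚ` (the subfield `maximalRealSubfield K` contains `ℚ`). -/
noncomputable def plusField : IntermediateField ℚ K :=
  (maximalRealSubfield K).toIntermediateField fun q => by
    rw [eq_ratCast]
    exact SubfieldClass.ratCast_mem _ q

/-- **`ℚ(ζ₇)⁺/ℚ` is abelian** — an intermediate field of the abelian extension `ℚ(ζ₇)/ℚ` (Mathlib's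
`IsCyclotomicExtension.isAbelianGalois` and the `IsAbelianGalois` instance for intermediate fields), with the
intermediate field's own `ℚ`-algebra structure. -/
theorem isAbelianGalois_plusField :
    @IsAbelianGalois ℚ (plusField K) _ _ (IntermediateField.algebra' (plusField K)) := by
  haveI := IsCyclotomicExtension.isAbelianGalois {7} ℚ K
  infer_instance

/-- **`ℚ(ζ₇)⁺/ℚ` is Galois** (the `ℚ`-algebra structure of a field of characteristic `0` is unique). -/
theorem isGalois_plusField : IsGalois ℚ (plusField K) := by
  have h := (isAbelianGalois_plusField K).toIsGalois
  have e : (IntermediateField.algebra' (plusField K) : Algebra ℚ (plusField K)) =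
      (inferInstance : Algebra ℚ (plusField K)) :=
    Subsingleton.elim _ _
  rw [e] at h
  exact h

/-- **`ℚ(ζ₇)⁺ = maximalRealSubfield ℚ(ζ₇)` is Galois over `ℚ`** (the subfield and the intermediate field carry the
same field structure). -/
theorem isGalois_maximalRealSubfield : IsGalois ℚ (maximalRealSubfield K) := isGalois_plusField K

variable (p : ℕ) [hp : Fact p.Prime] (h2 : orderOf (p : ZMod 7) = 2)

section Above

variable (P : Ideal (𝓞 K)) [P.IsPrime] [P.LiesOver (Ideal.span {(p : ℤ)})]

include h2 in
/-- Every prime of `𝓞_{ℚ(ζ₇)}` above `p` has inertia degree `orderOf (p mod 7) = 2` (Mathlib). -/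
theorem inertiaDeg_of_liesOver_of_orderOf_eq_two :
    haveI := numberField' K
    P.inertiaDeg ℤ = 2 := by
  haveI := numberField' K
  rw [IsCyclotomicExtension.Rat.inertiaDeg_eq_of_not_dvd (m := 7) p K P (not_dvd_seven_of_orderOf_eq_two p h2),
    h2]

include h2 in
/-- Every prime of `𝓞_{ℚ(ζ₇)}` above `p` is unramified over `ℤ` (Mathlib). -/
theorem ramificationIdx_of_liesOver_of_orderOf_eq_two :
    haveI := numberField' K
    P.ramificationIdx ℤ = 1 := by
  haveI := numberField' K
  exact IsCyclotomicExtension.Rat.ramificationIdx_eq_of_not_dvd (m := 7) p K P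
    (not_dvd_seven_of_orderOf_eq_two p h2)

end Above

section Place

variable (v : HeightOneSpectrum (𝓞 (maximalRealSubfield K))) [hv : v.asIdeal.LiesOver (Ideal.span {(p : ℤ)})]
include hv

/-- **`f(v/p) ∣ 3`** for every place `v` of the Galois cubic field `ℚ(ζ₇)⁺` above `p`. -/
theorem inertiaDeg_dvd_three :
    haveI := numberField' K; haveI := isCMField' K
    v.asIdeal.inertiaDeg ℤ ∣ 3 := by
  haveI := numberField' K
  haveI := isCMField' K
  haveI := isGalois_maximalRealSubfield K
  have h := inertiaDeg_dvd_finrank_of_isGalois (maximalRealSubfield K) p v.asIdeal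
  rwa [finrank_rat_maximalRealSubfield_seven K] at h

variable (w : HeightOneSpectrum (𝓞 K)) [hw : w.asIdeal.LiesOver v.asIdeal]
include hw

omit [CharZero K] [IsCyclotomicExtension {7} ℚ K] hp in
/-- A place of `ℚ(ζ₇)` above `v` lies above `p`. -/
theorem liesOver_int : w.asIdeal.LiesOver (Ideal.span {(p : ℤ)}) :=
  Ideal.LiesOver.trans w.asIdeal v.asIdeal (Ideal.span {(p : ℤ)})

include h2 in
/-- **The tower law `f(v/p) · f(w/v) = f(w/p) = 2`.** -/
theorem inertiaDeg_mul_eq_two :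
    haveI := numberField' K; haveI := isCMField' K
    v.asIdeal.inertiaDeg ℤ * w.asIdeal.inertiaDeg (𝓞 (maximalRealSubfield K)) = 2 := by
  haveI := numberField' K
  haveI := isCMField' K
  haveI := liesOver_int K p v w
  have htower := Ideal.inertiaDeg_tower (R := ℤ) v.asIdeal w.asIdeal
  rw [inertiaDeg_of_liesOver_of_orderOf_eq_two K p h2 w.asIdeal] at htower
  exact htower.symm

omit w hw in
include h2 in
/-- **`f(v/p) = 1`**: it divides both `3` (Galois cubic) and `2` (the tower law). -/
theorem inertiaDeg_eq_one :
    haveI := numberField' K; haveI := isCMField' K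
    v.asIdeal.inertiaDeg ℤ = 1 := by
  haveI := numberField' K
  haveI := isCMField' K
  obtain ⟨⟨P, hP, hPo⟩⟩ := Ideal.nonempty_primesOver (S := 𝓞 K) v.asIdeal
  haveI := hP
  haveI := hPo
  have h2' : v.asIdeal.inertiaDeg ℤ ∣ 2 :=
    ⟨_, (inertiaDeg_mul_eq_two K p h2 v ⟨P, hP, Ideal.ne_bot_of_liesOver_of_ne_bot v.ne_bot P⟩ (hw := hPo)).symm⟩
  have h := Nat.dvd_gcd h2' (inertiaDeg_dvd_three K p v)
  rwa [show Nat.gcd 2 3 = 1 by norm_num, Nat.dvd_one] at h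

include h2 in
/-- **`f(w/v) = 2`.** -/
theorem inertiaDeg_over_eq_two :
    haveI := numberField' K; haveI := isCMField' K
    w.asIdeal.inertiaDeg (𝓞 (maximalRealSubfield K)) = 2 := by
  haveI := numberField' K
  haveI := isCMField' K
  have h := inertiaDeg_mul_eq_two K p h2 v w
  rwa [inertiaDeg_eq_one K p h2 v, one_mul] at h

include h2 in
/-- **`e(w/v) = 1`**: `1 = e(w/p) = e(v/p) · e(w/v)` (the tower law, `𝓞_{ℚ(ζ₇)}` being flat over `𝓞_{ℚ(ζ₇)⁺}`). -/
theorem ramificationIdx_over_eq_one :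
    haveI := numberField' K; haveI := isCMField' K
    w.asIdeal.ramificationIdx (𝓞 (maximalRealSubfield K)) = 1 := by
  haveI := numberField' K
  haveI := isCMField' K
  haveI := liesOver_int K p v w
  have htower := Ideal.ramificationIdx_tower (R := ℤ) v.asIdeal w.asIdeal
  rw [ramificationIdx_of_liesOver_of_orderOf_eq_two K p h2 w.asIdeal] at htower
  exact Nat.eq_one_of_mul_eq_one_left htower.symm

include h2 in
/-- **`e(v/p) = 1`.** -/
theorem ramificationIdx_eq_one :
    haveI := numberField' K; haveI := isCMField' K
    v.asIdeal.ramificationIdx ℤ = 1 := by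
  haveI := numberField' K
  haveI := isCMField' K
  haveI := liesOver_int K p v w
  have htower := Ideal.ramificationIdx_tower (R := ℤ) v.asIdeal w.asIdeal
  rw [ramificationIdx_of_liesOver_of_orderOf_eq_two K p h2 w.asIdeal] at htower
  exact Nat.eq_one_of_mul_eq_one_right htower.symm

omit w hw in
include h2 in
/-- **Exactly one place of `ℚ(ζ₇)` above `v`**: the fundamental identity `#{w ∣ v} · e(w/v) · f(w/v) = 2` with
`e(w/v) = 1`, `f(w/v) = 2`. -/
theorem ncard_primesOver_eq_one :
    haveI := numberField' K; haveI := isCMField' K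
    (v.asIdeal.primesOver (𝓞 K)).ncard = 1 := by
  haveI := numberField' K
  haveI := isCMField' K
  obtain ⟨⟨P, hP, hPo⟩⟩ := Ideal.nonempty_primesOver (S := 𝓞 K) v.asIdeal
  haveI := hP
  haveI := hPo
  have h := ncard_primesOver_mul_eq_two K v
  rw [Ideal.ramificationIdxIn_eq_ramificationIdx v.asIdeal P (K ≃ₐ[maximalRealSubfield K] K),
    Ideal.inertiaDegIn_eq_inertiaDeg v.asIdeal P (K ≃ₐ[maximalRealSubfield K] K),
    ramificationIdx_over_eq_one K p h2 v ⟨P, hP, Ideal.ne_bot_of_liesOver_of_ne_bot v.ne_bot P⟩ (hw := hPo),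
    inertiaDeg_over_eq_two K p h2 v ⟨P, hP, Ideal.ne_bot_of_liesOver_of_ne_bot v.ne_bot P⟩ (hw := hPo),
    one_mul] at h
  exact Nat.eq_of_mul_eq_mul_right two_pos (h.trans (one_mul 2).symm)

include h2 in
/-- **`v` stays prime in `ℚ(ζ₇)`: `v 𝓞_K = w`** — the hypothesis `hmap` of files 233 / 236 at every place of
`ℚ(ζ₇)⁺` above `p` (file 236's `map_eq_of_ramificationIdx'_eq_one_of_ncard_primesOver_eq_one`). -/
theorem map_eq :
    haveI := numberField' K; haveI := isCMField' K
    Ideal.map (algebraMap (𝓞 (maximalRealSubfield K)) (𝓞 K)) v.asIdeal = w.asIdeal := by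
  haveI := numberField' K
  haveI := isCMField' K
  refine map_eq_of_ramificationIdx'_eq_one_of_ncard_primesOver_eq_one K v w ?_ (ncard_primesOver_eq_one K p h2 v)
  rw [Ideal.ramificationIdx'_eq_ramificationIdx v.asIdeal w.asIdeal v.ne_bot]
  exact ramificationIdx_over_eq_one K p h2 v w

omit w hw in
include h2 in
/-- **Some place `w` of `ℚ(ζ₇)` lies above `v` with `v 𝓞_K = w`.** -/
theorem exists_liesOver_and_map_eq :
    haveI := numberField' K; haveI := isCMField' K
    ∃ w : HeightOneSpectrum (𝓞 K), w.asIdeal.LiesOver v.asIdeal ∧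
      Ideal.map (algebraMap (𝓞 (maximalRealSubfield K)) (𝓞 K)) v.asIdeal = w.asIdeal := by
  haveI := numberField' K
  haveI := isCMField' K
  obtain ⟨⟨P, hP, hPo⟩⟩ := Ideal.nonempty_primesOver (S := 𝓞 K) v.asIdeal
  haveI := hP
  haveI := hPo
  exact ⟨⟨P, hP, Ideal.ne_bot_of_liesOver_of_ne_bot v.ne_bot P⟩, hPo,
    map_eq K p h2 v ⟨P, hP, Ideal.ne_bot_of_liesOver_of_ne_bot v.ne_bot P⟩ (hw := hPo)⟩

omit w hw in
include h2 in
/-- **`N(v) = p`**: `N(v) = N((p))^{f(v/p)} = p¹`. -/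
theorem absNorm_eq :
    haveI := numberField' K; haveI := isCMField' K
    Ideal.absNorm v.asIdeal = p := by
  haveI := numberField' K
  haveI := isCMField' K
  have h := Ideal.absNorm_pow_inertiaDeg (Ideal.span {(p : ℤ)}) v.asIdeal
  rw [absNorm_span_natCast_int, inertiaDeg_eq_one K p h2 v, pow_one] at h
  exact h.symm

omit w hw in
include h2 in
/-- **Exactly three places of `ℚ(ζ₇)⁺` above `p`**: the Galois fundamental identity `g · e · f = 3` with
`e(v/p) = f(v/p) = 1`. -/
theorem ncard_primesOver_int_eq_three :
    haveI := numberField' K; haveI := isCMField' K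
    ((Ideal.span {(p : ℤ)}).primesOver (𝓞 (maximalRealSubfield K))).ncard = 3 := by
  haveI := numberField' K
  haveI := isCMField' K
  haveI := isGalois_maximalRealSubfield K
  haveI : (Ideal.span {(p : ℤ)}).IsPrime :=
    (Ideal.span_singleton_prime (Nat.cast_ne_zero.mpr hp.out.ne_zero)).mpr (Nat.prime_iff_prime_int.mp hp.out)
  obtain ⟨⟨P, hP, hPo⟩⟩ := Ideal.nonempty_primesOver (S := 𝓞 K) v.asIdeal
  haveI := hP
  haveI := hPo
  have h := Ideal.ncard_primesOver_mul_ramificationIdxIn_mul_inertiaDegIn (Ideal.span {(p : ℤ)})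
    (𝓞 (maximalRealSubfield K)) (maximalRealSubfield K ≃ₐ[ℚ] maximalRealSubfield K)
  rw [Ideal.inertiaDegIn_eq_inertiaDeg _ v.asIdeal (maximalRealSubfield K ≃ₐ[ℚ] maximalRealSubfield K),
    Ideal.ramificationIdxIn_eq_ramificationIdx _ v.asIdeal (maximalRealSubfield K ≃ₐ[ℚ] maximalRealSubfield K),
    IsGaloisGroup.card_eq_finrank (maximalRealSubfield K ≃ₐ[ℚ] maximalRealSubfield K) ℚ (maximalRealSubfield K),
    finrank_rat_maximalRealSubfield_seven K, inertiaDeg_eq_one K p h2 v,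
    ramificationIdx_eq_one K p h2 v ⟨P, hP, Ideal.ne_bot_of_liesOver_of_ne_bot v.ne_bot P⟩ (hw := hPo),
    mul_one, mul_one] at h
  exact h

end Place

end Seven

section Thirteen

variable (K : Type*) [Field K] [CharZero K] [IsCyclotomicExtension {7} ℚ K]

/-- `13` has multiplicative order `2` modulo `7`. -/
theorem orderOf_thirteen_zmod_seven : orderOf (13 : ZMod 7) = 2 := by
  rw [orderOf_eq_iff (by norm_num)]
  decide

/-- `orderOf ((13 : ℕ) : ZMod 7) = 2` (the cast form used by the generic theorems). -/
theorem orderOf_natCast_thirteen_zmod_seven : orderOf ((13 : ℕ) : ZMod 7) = 2 := by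
  rw [Nat.cast_ofNat]
  exact orderOf_thirteen_zmod_seven

/-- `13` is prime (as a `Fact`, for the generic theorems). -/
theorem fact_prime_thirteen : Fact (Nat.Prime 13) := ⟨by norm_num⟩

/-- `(13)` is a prime of `ℤ`. -/
theorem isPrime_span_thirteen_int : (Ideal.span {(13 : ℤ)}).IsPrime :=
  (Ideal.span_singleton_prime (by norm_num)).mpr (by norm_num)

/-- **A place `v` of `ℚ(ζ₇)⁺` above `13` of norm `13` that stays prime in `ℚ(ζ₇)`** (`v 𝓞_K = w`) — the first
degree-one inert place of the field of record. -/
theorem exists_liesOver_thirteen_and_absNorm_eq_and_map_eq :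
    haveI := numberField' K; haveI := isCMField' K
    ∃ v : HeightOneSpectrum (𝓞 (maximalRealSubfield K)), v.asIdeal.LiesOver (Ideal.span {(13 : ℤ)}) ∧
      Ideal.absNorm v.asIdeal = 13 ∧ ∃ w : HeightOneSpectrum (𝓞 K),
        Ideal.map (algebraMap (𝓞 (maximalRealSubfield K)) (𝓞 K)) v.asIdeal = w.asIdeal := by
  haveI := numberField' K
  haveI := isCMField' K
  haveI := fact_prime_thirteen
  haveI := isPrime_span_thirteen_int
  obtain ⟨⟨Q, hQ, hQo⟩⟩ := Ideal.nonempty_primesOver (S := 𝓞 (maximalRealSubfield K)) (Ideal.span {(13 : ℤ)})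
  haveI := hQ
  haveI := hQo
  have hQo' : Q.LiesOver (Ideal.span {((13 : ℕ) : ℤ)}) := by rwa [Nat.cast_ofNat]
  have hne : Q ≠ ⊥ := Ideal.ne_bot_of_liesOver_of_ne_bot
    ((Ideal.span_singleton_eq_bot).not.mpr (by norm_num : (13 : ℤ) ≠ 0)) Q
  refine ⟨⟨Q, hQ, hne⟩, hQo, ?_, ?_⟩
  · exact absNorm_eq K 13 (hp := fact_prime_thirteen) orderOf_natCast_thirteen_zmod_seven ⟨Q, hQ, hne⟩
      (hv := hQo')
  · obtain ⟨w, -, hw⟩ := exists_liesOver_and_map_eq K 13 (hp := fact_prime_thirteen)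
      orderOf_natCast_thirteen_zmod_seven ⟨Q, hQ, hne⟩ (hv := hQo')
    exact ⟨w, hw⟩

/-- **Exactly three places of `ℚ(ζ₇)⁺` above `13`.** -/
theorem ncard_primesOver_thirteen :
    haveI := numberField' K; haveI := isCMField' K
    ((Ideal.span {(13 : ℤ)}).primesOver (𝓞 (maximalRealSubfield K))).ncard = 3 := by
  haveI := numberField' K
  haveI := isCMField' K
  haveI := fact_prime_thirteen
  haveI := isPrime_span_thirteen_int
  obtain ⟨⟨Q, hQ, hQo⟩⟩ := Ideal.nonempty_primesOver (S := 𝓞 (maximalRealSubfield K)) (Ideal.span {(13 : ℤ)})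
  haveI := hQ
  haveI := hQo
  have hQo' : Q.LiesOver (Ideal.span {((13 : ℕ) : ℤ)}) := by rwa [Nat.cast_ofNat]
  have hne : Q ≠ ⊥ := Ideal.ne_bot_of_liesOver_of_ne_bot
    ((Ideal.span_singleton_eq_bot).not.mpr (by norm_num : (13 : ℤ) ≠ 0)) Q
  have h := ncard_primesOver_int_eq_three K 13 (hp := fact_prime_thirteen) orderOf_natCast_thirteen_zmod_seven
    ⟨Q, hQ, hne⟩ (hv := hQo')
  rwa [Nat.cast_ofNat] at h

end Thirteen

end Summit.Ventures.HodgeRepro2.T5CyclotomicSevenDegreeOnePrime
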